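import Summits.QuantumFields.YangMills.Theorems.FluctuationComparisonRegPrIntLTailSupOneFibreRows
import Summits.QuantumFields.YangMills.Theorems.FluctuationComparisonRegPrIntLTailSupOneConvexTail
import HarnessLib

/-!
# `FluctuationComparisonRegPrIntLTailSupOneComparisonDoor` — LINE g21-2 «DEPTH-ONE WINDOW ODDS BY A MEASURE SPLIT»: MOD₁ ∕ FAR₁ ⟸ A FIBREWISE SUB-GAUSSIAN
# COMPARISON FAMILY — the Laplace argument's logical skeleton, probability discharged
# (crux `UnitScaleTilt.FluctuationComparisonRegPrIntL`, stmt-QuantumFields-20520; rows MOD₁ `ModerateFieldOddsDepthOneCan`, FAR₁ `FarFieldOddsDepthOneCan` of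
# `Cruxes/…/Lines/tailsup_one.lean`, ideator ym-r3-idea-1 g21)

Cell `ym3-torus` (YM ladder rung R3 = continuum SU(2) Yang–Mills on T³ — a RUNG, NOT the Clay problem: not d = 4, not infinite volume, not a mass gap);
width seat `ym-ust-20520-w3` (gen 17); helper `--supports stmt-QuantumFields-20520`.  THEOREMS ONLY (0 `def`, 0 `sorry`, default heartbeats).

WHY.  After ✓E (`gibbsK_restrict_map_le_of_fibrewise`) a MOD₁ hand owes, for Haar-a.e. window datum `V`, ONE inequality between two masses of the Boltzmann-weighted
conditional Haar law `κ_V` of the fine field: `κ_V(E_bad) ≤ σ·κ_V(histGood)`.  The Laplace ∕ log-concavity argument (✓F `convex_maxTail`, px20's F-BOX) produces it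
through a COMPARISON LAW: a probability measure `ν_V` (the gauge-fixed chart law of the fibre) and finitely many real observables `Y_p` (the fine plaquette functionals
read in the chart) with (α) the bad event's weighted mass dominated by `Z_V·ν_V{∃ p, θ ≤ |Y_p|}`, (β) the good event's weighted mass dominating `Z_V·ν_V{∀ p, |Y_p| < θ}`
(the SAME constant `Z_V`: the chart Jacobian's normalisation and `e^{−βA_min(V)}` cancel between numerator and denominator — this is where extensivity dies),
(γ) each `Y_p` sub-Gaussian with a constant `c` about a mean of size `≤ θ∕2` (uniform convexity ⇒ ✓F ∕ F-BOX; centring = the window-edge forcing number).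
This file proves (α)(β)(γ) ⇒ `κ_V(E_bad) ≤ 2x·κ_V(histGood)`, `x = 2·#s·e^{−θ²∕(8c)}`, once `x ≤ 1∕2` — measure arithmetic, no gauge field in sight — and docks it into ✓E.
* §1 (generic) `measureReal_forall_lt_eq` (the all-small event is the complement of the max-tail event), ★`subgaussian_maxTail_of_centred` (sub-Gaussian about means
  `≤ θ∕2` ⇒ `ν{∃ p, θ ≤ |Y_p|} ≤ 2·#s·e^{−(θ∕2)²∕(2c)}`, via ✓F `maxTail_of_hasSubgaussianMGF`), ★★`mass_le_of_comparison` ((α)(β) + tail `≤ x ≤ 1∕2` ⇒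
  `κ(E) ≤ ofReal(2x)·κ(G)` in `ℝ≥0∞`, by monotone multiplication only: `2x(1 − x) ≥ x`).
* §2 (the runs) ★★★`gibbsK_restrict_map_le_of_comparison` — an a.e.-`V` family of comparison data (α)(β)(γ) on a fixed model space with uniform `θ`, `c` and a
  tail budget `2·#s·e^{−(θ∕2)²∕(2c)} ≤ x ≤ 1∕2` ⇒ `(D_*(Gibbs_K|E))|W_J ≤ ofReal (2x) • (D_*(Gibbs_K|G))|W_J` (✓E).  At `K = J+1`, `G = histGood`,
  `E = histGoodᶜ ∩ {PlaqSmall δ₀}`: MOD₁'s inequality with `σ₁(J) = 2x_J`; with `θ = θ_{J+1} = g·p(g)` and `c = g²L²∕m`: `x_J = 2N_{J+1}·e^{−m·p(g_{J+1})²∕(8L²)}`, the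
  shape whose level sums ✓D `gaussianWindowOdds_levelSum_le` (`m ↦ m∕4`, `R² ↦ L²`) makes `≤ A'·2^{−J}`, super-polynomial.
HONEST SCOPE.  Measure arithmetic; the comparison family (chart, convexity, centring, the two mass comparisons) is MOD₁'s content and is NOT constructed; MOD₁, FAR₁,
TAILSUP₁, LFR♯ᶜ, S2β, 20520, `YM3TorusSU2` NOT proved; the Yang–Mills mass gap is NOT proved.
References: [Balaban1985UV3] (7) p. 257, (38)–(41) p. 266; [BoucheronLugosiMassart2013] §2.3, §2.5; [Balaban1985Averaging] (10) p. 19.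
-/

noncomputable section

set_option autoImplicit false

open MeasureTheory ProbabilityTheory Filter Topology Set
open scoped ENNReal NNReal
open Literature.MathematicalPhysics.QuantumFieldTheory.Balaban1983to89
open Literature.MathematicalPhysics.QuantumFieldTheory.Balaban1983to89.T3ContinuumYM3Torus
open Literature.MathematicalPhysics.QuantumFieldTheory.Balaban1983to89.T3NestedUnitLaws
open Literature.MathematicalPhysics.QuantumFieldTheory.Balaban1983to89.T3UnitLawDensityEML
open Literature.MathematicalPhysics.QuantumFieldTheory.Balaban1983to89.T3UnitScaleTilt
open Literature.MathematicalPhysics.QuantumFieldTheory.Balaban1983to89.T3TiltDescent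
open Literature.MathematicalPhysics.QuantumFieldTheory.Balaban1983to89.Missing
open Literature.MathematicalPhysics.QuantumFieldTheory.Balaban1983to89.T4AveragingDisintegration
open Summit.QuantumFields.YangMills.Theorems.FluctuationComparisonRegPrIntLTailSupOneFibreRows (gibbsK_restrict_map_le_of_fibrewise)
open Summit.QuantumFields.YangMills.Theorems.FluctuationComparisonRegPrIntLTailSupOneConvexTail (maxTail_of_hasSubgaussianMGF)

namespace Summit.QuantumFields.YangMills.Theorems.FluctuationComparisonRegPrIntLTailSupOneComparisonDoor

/-! ## §1 Generic: a sub-Gaussian comparison family turns a bad-vs-good mass comparison into a ratio -/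

section Generic

variable {Y : Type*} [MeasurableSpace Y] (ν : Measure Y) {A : Type*} (s : Finset A) (obs : A → Y → ℝ)

/-- The max-tail event of a finite family of measurable observables is measurable. [folklore] -/
theorem measurableSet_exists_le_abs (hobs : ∀ p ∈ s, Measurable (obs p)) (θ : ℝ) :
    MeasurableSet {y | ∃ p ∈ s, θ ≤ |obs p y|} := by
  have hset : {y | ∃ p ∈ s, θ ≤ |obs p y|} = ⋃ p ∈ s, {y | θ ≤ |obs p y|} := by
    ext y; simp
  rw [hset]
  exact MeasurableSet.biUnion (Finset.countable_toSet s) fun p hp =>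
    measurableSet_le measurable_const ((hobs p hp).abs)

/-- **ALL-SMALL = COMPLEMENT OF SOME-LARGE**: for a probability measure, `ν{∀ p ∈ s, |Y_p| < θ} = 1 − ν{∃ p ∈ s, θ ≤ |Y_p|}`. [folklore] -/
theorem measureReal_forall_lt_eq [IsProbabilityMeasure ν] (hobs : ∀ p ∈ s, Measurable (obs p)) (θ : ℝ) :
    ν.real {y | ∀ p ∈ s, |obs p y| < θ} = 1 - ν.real {y | ∃ p ∈ s, θ ≤ |obs p y|} := by
  have hcompl : {y | ∀ p ∈ s, |obs p y| < θ} = {y | ∃ p ∈ s, θ ≤ |obs p y|}ᶜ := by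
    ext y
    simp only [Set.mem_setOf_eq, Set.mem_compl_iff, not_exists, not_and, not_le]
  rw [hcompl, measureReal_compl (measurableSet_exists_le_abs s obs hobs θ), probReal_univ]

/-- ★ **THE MAX-TAIL OF A FAMILY SUB-GAUSSIAN ABOUT SMALL MEANS**: if every `Y_p − m_p` (`p ∈ s`) is sub-Gaussian with constant `c` under the probability
measure `ν` and `|m_p| ≤ θ∕2` (`θ ≥ 0`), then `ν{∃ p ∈ s, θ ≤ |Y_p|} ≤ 2·#s·exp(−(θ∕2)²∕(2c))` (`θ ≤ |Y| ⇒ θ∕2 ≤ |Y − m|`; ✓F `maxTail_of_hasSubgaussianMGF`).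
[cite: BoucheronLugosiMassart2013, §2.5] -/
theorem subgaussian_maxTail_of_centred [IsProbabilityMeasure ν] (m : A → ℝ) (c : ℝ≥0)
    (h : ∀ p ∈ s, HasSubgaussianMGF (fun y => obs p y - m p) c ν) {θ : ℝ} (hθ : 0 ≤ θ) (hm : ∀ p ∈ s, |m p| ≤ θ / 2) :
    ν.real {y | ∃ p ∈ s, θ ≤ |obs p y|} ≤ 2 * s.card * Real.exp (-(θ / 2) ^ 2 / (2 * c)) := by
  have hsub : {y | ∃ p ∈ s, θ ≤ |obs p y|} ⊆ {y | ∃ p ∈ s, θ / 2 ≤ |(fun y => obs p y - m p) y|} := by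
    rintro y ⟨p, hp, hy⟩
    refine ⟨p, hp, ?_⟩
    have h1 : |obs p y| - |m p| ≤ |obs p y - m p| := abs_sub_abs_le_abs_sub _ _
    have h2 := hm p hp
    show θ / 2 ≤ |obs p y - m p|
    linarith
  exact (measureReal_mono hsub).trans (maxTail_of_hasSubgaussianMGF ν s (fun p y => obs p y - m p) c h (by linarith))

/-- ★★ **A BAD-VS-GOOD COMPARISON THROUGH ONE LAW GIVES A RATIO** (`ℝ≥0∞` arithmetic, monotone multiplication only): if `κE ≤ Z·ofReal(ν bad)`,
`Z·ofReal(ν good) ≤ κG`, `ν bad ≤ x`, `1 − x ≤ ν good` and `0 ≤ x ≤ 1∕2`, then `κE ≤ ofReal(2x)·κG` (because `2x·(1 − x) ≥ x`). [folklore] -/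
theorem mass_le_of_comparison {κE κG Z : ℝ≥0∞} {bad good x : ℝ} (hα : κE ≤ Z * ENNReal.ofReal bad) (hβ : Z * ENNReal.ofReal good ≤ κG)
    (hbad : bad ≤ x) (hgood : 1 - x ≤ good) (hx0 : 0 ≤ x) (hx : x ≤ 1 / 2) :
    κE ≤ ENNReal.ofReal (2 * x) * κG := by
  have h1 : κE ≤ Z * ENNReal.ofReal x := hα.trans (mul_le_mul' le_rfl (ENNReal.ofReal_le_ofReal hbad))
  have hx2 : x ≤ 2 * x * (1 - x) := by nlinarith
  have h2 : ENNReal.ofReal x ≤ ENNReal.ofReal (2 * x) * ENNReal.ofReal good := by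
    rw [← ENNReal.ofReal_mul (by linarith)]
    refine ENNReal.ofReal_le_ofReal (hx2.trans ?_)
    exact mul_le_mul_of_nonneg_left hgood (by linarith)
  calc κE ≤ Z * ENNReal.ofReal x := h1
    _ ≤ Z * (ENNReal.ofReal (2 * x) * ENNReal.ofReal good) := mul_le_mul' le_rfl h2
    _ = ENNReal.ofReal (2 * x) * (Z * ENNReal.ofReal good) := by ring
    _ ≤ ENNReal.ofReal (2 * x) * κG := mul_le_mul' le_rfl hβ

/-- ★★ **(α)(β)(γ) ⇒ THE FIBRE INEQUALITY**: a probability law `ν`, measurable observables `Y_p` sub-Gaussian (`c`) about means `|m_p| ≤ θ∕2`, a constant `Z` with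
`κE ≤ Z·ofReal(ν{∃ p, θ ≤ |Y_p|})` and `Z·ofReal(ν{∀ p, |Y_p| < θ}) ≤ κG`, and a tail budget `2·#s·e^{−(θ∕2)²∕(2c)} ≤ x ≤ 1∕2` ⟹ `κE ≤ ofReal(2x)·κG`.
[cite: Balaban1985UV3, (38)-(41) p.266; BoucheronLugosiMassart2013, §2.5] -/
theorem mass_le_of_subgaussian_comparison [IsProbabilityMeasure ν] (hobs : ∀ p ∈ s, Measurable (obs p)) (m : A → ℝ) (c : ℝ≥0)
    (h : ∀ p ∈ s, HasSubgaussianMGF (fun y => obs p y - m p) c ν) {θ : ℝ} (hθ : 0 ≤ θ) (hm : ∀ p ∈ s, |m p| ≤ θ / 2)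
    {κE κG Z : ℝ≥0∞} (hα : κE ≤ Z * ENNReal.ofReal (ν.real {y | ∃ p ∈ s, θ ≤ |obs p y|}))
    (hβ : Z * ENNReal.ofReal (ν.real {y | ∀ p ∈ s, |obs p y| < θ}) ≤ κG)
    {x : ℝ} (htail : 2 * s.card * Real.exp (-(θ / 2) ^ 2 / (2 * c)) ≤ x) (hx : x ≤ 1 / 2) :
    κE ≤ ENNReal.ofReal (2 * x) * κG := by
  have hbad : ν.real {y | ∃ p ∈ s, θ ≤ |obs p y|} ≤ x := (subgaussian_maxTail_of_centred ν s obs m c h hθ hm).trans htail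
  have hx0 : 0 ≤ x := measureReal_nonneg.trans hbad
  have hgood : 1 - x ≤ ν.real {y | ∀ p ∈ s, |obs p y| < θ} := by
    rw [measureReal_forall_lt_eq ν s obs hobs θ]
    linarith
  exact mass_le_of_comparison hα hβ hbad hgood hx0 hx

end Generic

/-! ## §2 The runs: MOD₁ ∕ FAR₁-shaped rows from an a.e.-fibrewise sub-Gaussian comparison family -/

section Runs

variable (F : T3Family) {γ : ℝ} (b₀ p₀ : ℝ) {J K : ℕ} (hJK : J ≤ K)

/-- ★★★ **`(D_*(Gibbs_K|E))|W_J ≤ ofReal(2x) • (D_*(Gibbs_K|G))|W_J` ⟸ A FIBREWISE SUB-GAUSSIAN COMPARISON FAMILY**.  Data on a fixed model space `Y` (the chart ∕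
gauge-fixed slice), depending freely on the window datum `V`: probability laws `ν_V`, measurable observables `Y_{V,p}` (`p ∈ s`, e.g. the run-`K` plaquette
functionals of one height-`J` cell read in the chart), means `m_{V,p}`, constants `Z_V`; uniform threshold `θ ≥ 0`, sub-Gaussian constant `c`, tail budget
`2·#s·e^{−(θ∕2)²∕(2c)} ≤ x ≤ 1∕2`.  If for `(dU.map D_{J,K})`-a.e. `V` with `PlaqSmall θ_J V`: (γ) every `Y_{V,p} − m_{V,p}` is sub-Gaussian `c` under `ν_V` with
`|m_{V,p}| ≤ θ∕2`, (α) `∫⁻_E e^{−β_K A} dκ_V ≤ Z_V·ofReal(ν_V{∃ p, θ ≤ |Y_{V,p}|})`, (β) `Z_V·ofReal(ν_V{∀ p, |Y_{V,p}| < θ}) ≤ ∫⁻_G e^{−β_K A} dκ_V`, then the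
descended restricted Gibbs measures satisfy MOD₁'s ∕ FAR₁'s inequality shape with `σ = 2x` (✓E `gibbsK_restrict_map_le_of_fibrewise` ∘ §1).  At `K = J+1`,
`G = histGood`, `E = histGoodᶜ ∩ {PlaqSmall δ₀}`, `θ = θ_{J+1} = g·p(g)`, `c = g²L²∕m`: `x_J = 2N_{J+1}·e^{−m·p(g_{J+1})²∕(8L²)}`, super-polynomial by ✓D.
[cite: Balaban1985UV3, (7) p.257 and (38)-(41) p.266; Balaban1985Averaging, (10) p.19] -/
theorem gibbsK_restrict_map_le_of_comparison
    {E G : Set (GaugeField (F.P K) 0 (Matrix.specialUnitaryGroup (Fin 2) ℂ))} (hE : MeasurableSet E) (hG : MeasurableSet G)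
    {Y : Type*} [MeasurableSpace Y] (νf : GaugeField (F.P J) 0 (Matrix.specialUnitaryGroup (Fin 2) ℂ) → Measure Y)
    (hprob : ∀ V, IsProbabilityMeasure (νf V)) {A : Type*} (s : Finset A)
    (obsf : GaugeField (F.P J) 0 (Matrix.specialUnitaryGroup (Fin 2) ℂ) → A → Y → ℝ) (hobs : ∀ V, ∀ p ∈ s, Measurable (obsf V p))
    (mf : GaugeField (F.P J) 0 (Matrix.specialUnitaryGroup (Fin 2) ℂ) → A → ℝ)
    (Zf : GaugeField (F.P J) 0 (Matrix.specialUnitaryGroup (Fin 2) ℂ) → ℝ≥0∞) (c : ℝ≥0) {θ x : ℝ} (hθ : 0 ≤ θ)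
    (htail : 2 * s.card * Real.exp (-(θ / 2) ^ 2 / (2 * c)) ≤ x) (hx : x ≤ 1 / 2)
    (hfib : ∀ᵐ V ∂((fieldMeasure (F.P K) 0 (Matrix.specialUnitaryGroup (Fin 2) ℂ)).map (descendTo F ℰp J K hJK)),
      PlaqSmall (θBal F.L γ b₀ p₀ J) V →
        (∀ p ∈ s, HasSubgaussianMGF (fun y => obsf V p y - mf V p) c (νf V)) ∧ (∀ p ∈ s, |mf V p| ≤ θ / 2) ∧
        ∫⁻ U in E, ENNReal.ofReal (boltzmann (F.P K) ((F.scheme ℰp γ).β K) U)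
            ∂(condLaw (fieldMeasure (F.P K) 0 (Matrix.specialUnitaryGroup (Fin 2) ℂ)) (descendTo F ℰp J K hJK) V) ≤
          Zf V * ENNReal.ofReal ((νf V).real {y | ∃ p ∈ s, θ ≤ |obsf V p y|}) ∧
        Zf V * ENNReal.ofReal ((νf V).real {y | ∀ p ∈ s, |obsf V p y| < θ}) ≤
          ∫⁻ U in G, ENNReal.ofReal (boltzmann (F.P K) ((F.scheme ℰp γ).β K) U)
            ∂(condLaw (fieldMeasure (F.P K) 0 (Matrix.specialUnitaryGroup (Fin 2) ℂ)) (descendTo F ℰp J K hJK) V)) :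
    (Measure.map (descendTo F ℰp J K hJK) ((gibbsK F ℰp γ K).restrict E)).restrict
        {U : GaugeField (F.P J) 0 (Matrix.specialUnitaryGroup (Fin 2) ℂ) | PlaqSmall (θBal F.L γ b₀ p₀ J) U} ≤
      ENNReal.ofReal (2 * x) •
        (Measure.map (descendTo F ℰp J K hJK) ((gibbsK F ℰp γ K).restrict G)).restrict
          {U : GaugeField (F.P J) 0 (Matrix.specialUnitaryGroup (Fin 2) ℂ) | PlaqSmall (θBal F.L γ b₀ p₀ J) U} := by
  refine gibbsK_restrict_map_le_of_fibrewise F b₀ p₀ hJK hE hG (σ := 2 * x) ?_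
  filter_upwards [hfib] with V hV hVW
  obtain ⟨hsg, hm, hα, hβ⟩ := hV hVW
  haveI := hprob V
  exact mass_le_of_subgaussian_comparison (νf V) s (obsf V) (hobs V) (mf V) c hsg hθ hm hα hβ htail hx

end Runs

end Summit.QuantumFields.YangMills.Theorems.FluctuationComparisonRegPrIntLTailSupOneComparisonDoor

end
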